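import Summits.QuantumFields.YangMills.Theorems.TwoPointSynchronisation.Negative.SlowSet
import Literature.MathematicalPhysics.QuantumLattice.GaugeGroupsProofs

/-!
# `TwoPointSynchronisation` — negative lemma modulo `SZZFlowSU2`
# (bounded MEASURABLE observables cannot synchronise at a rate uniform in the observable:
# pathwise synchronisation without coalescence is Wasserstein, never total variation)

Crux `stmt-QuantumFields-17976` (`Summit.QuantumFields.YangMills.Theses.NoiseSynchronisation.TwoPointSynchronisation`,
route `NoiseSynchronisation`, rank 2): for every compact simple `G` and faithful `r` there is `β₀` such that for every
`β ≥ β₀` there are ONE rate `γ > 0` and `S₁` such that for EVERY `A : YMSpecies G` — every bounded measurable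
gauge-invariant cylinder function — there is `C` with, on every torus `S ≥ S₁`, for every flat Brownian motion and
every jointly measurable family of strong solutions `U` of the Shen–Zhu–Zhu Langevin SDE from all starts,
`∫ |A(lift U^x_t) − A(lift U^y_t)| d(μ_β ⊗ μ_β ⊗ P) ≤ C e^{−γ t}` for all `t`.

`twoPointSynchronisation_false_of_szzFlowSU2 : SZZFlowSU2 → ¬ TwoPointSynchronisation` — the crux is false MODULO
`H = SZZFlowSU2`: for `SU(2)` in the fundamental representation, at every coupling and on every torus `S ≥ 1`, one
probability space carrying a flat link Brownian motion and a jointly measurable strong-solution family from all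
starts (verbatim the crux's hypotheses, i.e. the `∃ U` body of route item `LangevinFlow`) for which `μ_β` is
stationary and two solutions from independent `μ_β`-starts never have exactly equal plaquette trace. Every clause
of `H` is a standard fact about the SZZ dynamics (SZZ §3 well-posedness and Lemma 3.2; Kunita's stochastic flows of
diffeomorphisms; null zero sets of real-analytic functions); none is constructible here because the tree's Itô
layer (`Literature.Probability.Process.IsItoIntegral`) is characterised, not constructed.

PROOF (parts I–II `IndicatorPatterns.lean`, `SlowSet.lean` and this file; tree objects only, axioms `propext` /
`Classical.choice` / `Quot.sound`). The abstract lemma `exists_slow_set` (part II): if real random variables `u k`, `v k` (`k ∈ ℕ`) on a probability space all have the same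
law `ν` and `M{u k = v k} = 0` for every `k`, then for every `γ > 0` there is a Borel `E ⊂ ℝ` with
`sup_k e^{γ k} M(1_E(u k) ≠ 1_E(v k)) = ∞`. If `ν` has an atom `c`, `E = {c}`. Otherwise the cdf is continuous
(`continuous_cdf_of_noAtoms`) and one builds blocks `B_i = (a_{i+1}, a_i]` with `cdf a_{i+1} = cdf a_i / 25`
(`exists_cdf_eq`), masses `m_i`, tails `m_i/24`; times `k_i` with `e^{−γ k_i} ≤ m_i/(i+1)` (`exists_exp_le`); scales
`δ_i` with `M(|u − v| < δ_i) ≤ m_i/20` at time `k_i` (continuity from above and non-coalescence); cells of width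
`δ_i`; and bit patterns on the cells chosen SEQUENTIALLY by the single-bit-flip averaging `exists_pattern` (flipping
the bit of `u`'s cell toggles disagreement on every good pair, `mem_disagreeSet_flipAt`, so some pattern makes at
least half of the good pairs disagree, whatever was fixed on earlier blocks). With `E = ⋃ patterns`, at time `k_i`
the disagreement mass is `≥ (19/40 − 1/24) m_i ≥ 0.4 (i+1) e^{−γ k_i}`. The plumbing instantiates the crux at
`G = SU(2)` (compact simple by the tree's `isSimpleCompactGroup_specialUnitaryGroup_holds`), `r` fundamental, `β = β₀`, `S = max S₁ 1`, takes
`(Ω, P, W, U)` from `H`, sets `u k = Re tr U^x_k(p₀)`, `v k = Re tr U^y_k(p₀)` (laws `= (Re tr ·_{p₀})_* μ_β` by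
stationarity, `Measure.map_prod_map` / `map_snd_prod`), feeds the slow set `E` into the crux as the species
`indicatorSpecies E = 1_E(Re tr U_{p₀})` (bounded, measurable, cylinder, gauge invariant), and reads the crux's
integral as `M(1_E(u k) ≠ 1_E(v k))` (`integral_abs_indicator_sub`): `C e^{−γ k} < M(…) ≤ C e^{−γ k}`.

CLASS if `H` is inhabited: refuted-MISSTATED. The witness exploits `A` ranging over DISCONTINUOUS observables with
`γ` chosen before `A`: a negative top Lyapunov exponent gives pathwise synchronisation WITHOUT coalescence (the
solution maps are diffeomorphisms), i.e. Wasserstein/Lipschitz-dual convergence of the two-point law to the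
diagonal, which controls only observables with a modulus of continuity. Repaired statement C′ (believed to be what
the route means; the witness misses it since indicators are not Lipschitz): quantify `A` over gauge-invariant
cylinder observables that are LIPSCHITZ for the chordal link metric on their support, the constant entering `C`:
`… ∃ S₁ : ℕ, ∀ A : YMSpecies G, ∀ L_A : ℝ, (∀ U V, |A.F U − A.F V| ≤ L_A * ∑ e ∈ A.supp, frobNorm (r.ρ (U e) − r.ρ (V e)))
 → ∃ C : ℝ, ∀ S, S₁ ≤ S → … (verbatim) …`.
CONSEQUENCE for the route: `SynchronisationToClustering` consumes the synchronisation body for ALL species; with C′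
it yields Euclidean-time clustering for Lipschitz species only, and the `UniformLatticeGap` body (all bounded
measurable species, as `HasLatticeMassGap` demands) needs an explicit extra step at the level of the MEASURE.
MESSAGE FOR PROVERS of the crux as typed: any proof must produce total-variation merging of the two-point law
(`M(U^x_t ≠ U^y_t mod gauge) → 0` exponentially), which an SDE flow of diffeomorphisms never does — do not spend
time on it before the planner restates.
-/

set_option autoImplicit false

noncomputable section

open MeasureTheory Set Filter Topology ProbabilityTheory
open scoped ENNReal
open Literature.MathematicalPhysics.QuantumFieldTheory Literature.MathematicalPhysics.QuantumLattice

namespace Summit.QuantumFields.YangMills.Theorems.TwoPointSynchronisation.Negative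

/-- `SU(2)` as a matrix group. [folklore] -/
abbrev SU2 : Type := Matrix.specialUnitaryGroup (Fin 2) ℂ

/-- The fundamental lattice representation of `SU(2)`. [folklore] -/
def su2Fund : LatticeRep SU2 :=
  ⟨2, fundamentalRep (Fin 2), continuous_fundamentalRep _, fundamentalRep_injective _,
    fundamentalRep_mem_unitaryGroup⟩

/-- The plaquette trace `Re tr U_p` at the origin in the `(0,1)` plane, read on torus
configurations through the periodic lift (exactly as the crux reads observables). [folklore] -/
def plaq (S : ℕ) (U : GaugeConfig 4 (2 * S + 1) SU2) : ℝ :=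
  plaquetteObs su2Fund.ρ 0 0 1 (torusLift (2 * S + 1) U)

/-- The lifted plaquette trace is measurable (continuity; `SU(2)^E` is second countable). [folklore] -/
theorem measurable_plaq (S : ℕ) : Measurable (plaq S) :=
  (measurable_plaquetteObs su2Fund.ρ su2Fund.continuous 0 0 1).comp
    (measurable_pi_lambda _ fun _ => measurable_pi_apply _)

/-- The indicator observable `1_E(Re tr U_p)`: a bounded measurable gauge-invariant cylinder
function, i.e. a `YMSpecies`. [folklore] -/
def indicatorSpecies (E : Set ℝ) (hE : MeasurableSet E) : YMSpecies SU2 where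
  F := fun V => E.indicator (fun _ => (1 : ℝ)) (plaquetteObs su2Fund.ρ 0 0 1 V)
  supp := originPlaquetteSupport 0 1
  isCylinder := fun U V h => by
    show E.indicator _ (plaquetteObs su2Fund.ρ 0 0 1 U) = E.indicator _ (plaquetteObs su2Fund.ρ 0 0 1 V)
    rw [isCylinder_plaquetteObs_zero su2Fund.ρ 0 1 h]
  gaugeInvariant := fun g U => by
    show E.indicator _ (plaquetteObs su2Fund.ρ 0 0 1 (gaugeTransformZd g U)) =
      E.indicator _ (plaquetteObs su2Fund.ρ 0 0 1 U)
    rw [isZdGaugeInvariant_plaquetteObs su2Fund.ρ 0 0 1 g U]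
  bounded := ⟨1, fun U => by
    by_cases h : plaquetteObs su2Fund.ρ 0 0 1 U ∈ E <;> simp [Set.indicator, h]⟩
  measurable := (measurable_const.indicator hE).comp
    (measurable_plaquetteObs su2Fund.ρ su2Fund.continuous 0 0 1)

/-- **H — `SZZFlowSU2`: the Shen–Zhu–Zhu flow of `SU(2)₄` lattice Yang–Mills exists, is stationary and does not
coalesce (not constructible in the tree today).** For `SU(2)` in the fundamental representation, every coupling
`β` and every torus `(2S+1)⁴` with `S ≥ 1`: there are a probability space (in `Type`) carrying a flat link Brownian
motion `W` and a family `(U^x)_x` of strong solutions of the SZZ Langevin SDE `latticeLangevinDynamics su2Fund β`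
from all starts, adapted to the raw natural filtration of `W` and jointly measurable in (start, ω) — verbatim the
hypotheses of the crux and the `∃ U` body of route item `LangevinFlow` (SZZ §3: global well-posedness Lemma between
Lemmas 3.1 and 3.2, for `SU(N)`; joint measurability from the flow version) — such that
(i) STATIONARITY: for a `μ_β`-distributed start independent of `W`, `U^x_t ∼ μ_β` for every `t`
(SZZ Lemma 3.2, invariance of the lattice Yang–Mills measure, plus Fubini); and
(ii) NON-COALESCENCE of the plaquette trace: for `μ_β ⊗ μ_β ⊗ P`-almost every `(x, y, ω)` and every `t`,
`Re tr U^x_t(p₀) ≠ Re tr U^y_t(p₀)` at the origin plaquette `p₀` (the solution maps have a version that is a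
stochastic flow of `C^∞` diffeomorphisms of the compact manifold `SU(2)^E` — Kunita, Saint-Flour XII, Ch. II
Thm. 4.6.5-type theorem for SDEs with smooth coefficients — so the two-point law of `(U^x_t, U^y_t)` is absolutely
continuous with respect to `Haar ⊗ Haar`, and `{(a, b) : Re tr a_{p₀} = Re tr b_{p₀}}` is the zero set of a
non-constant real-analytic function on the connected analytic manifold `(SU(2)^E)²`, hence null — Mityagin,
Prop. 1). All clauses are standard; none is provable here because the tree's Itô integral is a characterising
predicate whose existence theorem is a named fact. This is the hypothesis `H` of the negative lemma
`twoPointSynchronisation_false_of_szzFlowSU2 : H → ¬ TwoPointSynchronisation`, deliberately with no `_holds`.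
[cite: ShenZhuZhu2022, §3 well-posedness Lemma and Lemma 3.2] [cite: Kunita1984, Ch. II §4 (stochastic flows of diffeomorphisms)]
[cite: Mityagin2015, Prop. 1] -/
@[conjecture] def SZZFlowSU2 : Prop :=
  ∀ (β : ℝ) (S : ℕ), 1 ≤ S →
    ∃ (Ω : Type) (_ : MeasurableSpace Ω) (P : Measure Ω) (_ : IsProbabilityMeasure P)
      (W : NNReal → Ω → (Edge 4 (2 * S + 1) × NoiseIdx su2Fund.N → ℝ)) (hW : IsFlatBrownian W P)
      (U : GaugeConfig 4 (2 * S + 1) SU2 → NNReal → Ω → GaugeConfig 4 (2 * S + 1) SU2),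
      (∀ x, (∀ ω, U x 0 ω = x) ∧ (latticeLangevinDynamics (d := 4) (L := 2 * S + 1) su2Fund β).IsSolution
        su2Fund.ρ hW.natFiltration P W (U x)) ∧
      (∀ t, Measurable (fun p : GaugeConfig 4 (2 * S + 1) SU2 × Ω => U p.1 t p.2)) ∧
      (∀ t : NNReal, ((wilsonMeasure (d := 4) (L := 2 * S + 1) su2Fund.ρ β).prod P).map
          (fun q : GaugeConfig 4 (2 * S + 1) SU2 × Ω => U q.1 t q.2) =
            wilsonMeasure (d := 4) (L := 2 * S + 1) su2Fund.ρ β) ∧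
      (∀ t : NNReal, ((wilsonMeasure (d := 4) (L := 2 * S + 1) su2Fund.ρ β).prod
          ((wilsonMeasure (d := 4) (L := 2 * S + 1) su2Fund.ρ β).prod P))
          {p | plaq S (U p.1 t p.2.2) = plaq S (U p.2.1 t p.2.2)} = 0)

/-- The integral of `|1_E(x) - 1_E(y)|` is the measure of the symmetric difference. [folklore] -/
theorem integral_abs_indicator_sub {Λ : Type*} [MeasurableSpace Λ] (M : Measure Λ) [IsFiniteMeasure M]
    {f g : Λ → ℝ} (hf : Measurable f) (hg : Measurable g) {E : Set ℝ} (hE : MeasurableSet E) :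
    ∫ p, |E.indicator (fun _ => (1 : ℝ)) (f p) - E.indicator (fun _ => (1 : ℝ)) (g p)| ∂M =
      M.real (symmDiff (f ⁻¹' E) (g ⁻¹' E)) := by
  have hset : MeasurableSet (symmDiff (f ⁻¹' E) (g ⁻¹' E)) := (hf hE).symmDiff (hg hE)
  rw [← integral_indicator_one hset]
  refine integral_congr_ae (ae_of_all _ fun p => ?_)
  by_cases h1 : f p ∈ E <;> by_cases h2 : g p ∈ E <;>
    simp [Set.indicator, h1, h2, mem_symmDiff]

/-- **`TwoPointSynchronisation` is false once the SZZ flow exists** (negative lemma modulo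
`SZZFlowSU2`). [folklore] -/
theorem twoPointSynchronisation_false_of_szzFlowSU2 (hH : SZZFlowSU2) :
    ¬ Summit.QuantumFields.YangMills.Theses.NoiseSynchronisation.TwoPointSynchronisation := by
  intro hSync
  obtain ⟨β₀, hβ₀⟩ := hSync SU2
    (isCompactSimpleLieGroup_specialUnitaryGroup isSimpleCompactGroup_specialUnitaryGroup_holds le_rfl) su2Fund
  obtain ⟨γ, hγ, S₁, hA⟩ := hβ₀ β₀ le_rfl
  set S : ℕ := max S₁ 1 with hSdef
  have hS₁ : S₁ ≤ S := le_max_left _ _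
  have hS1 : 1 ≤ S := le_max_right _ _
  obtain ⟨Ω, mΩ, P, hP, W, hW, U, hsol, hmeas, hstat, hnc⟩ := hH β₀ S hS1
  set μ : Measure (GaugeConfig 4 (2 * S + 1) SU2) :=
    wilsonMeasure (d := 4) (L := 2 * S + 1) su2Fund.ρ β₀ with hμ
  haveI : IsProbabilityMeasure μ :=
    isProbabilityMeasure_wilsonMeasure (d := 4) (L := 2 * S + 1) su2Fund.ρ su2Fund.continuous β₀
  let M : Measure (GaugeConfig 4 (2 * S + 1) SU2 × (GaugeConfig 4 (2 * S + 1) SU2 × Ω)) :=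
    μ.prod (μ.prod P)
  let u : ℕ → GaugeConfig 4 (2 * S + 1) SU2 × (GaugeConfig 4 (2 * S + 1) SU2 × Ω) → ℝ :=
    fun k p => plaq S (U p.1 (k : NNReal) p.2.2)
  let v : ℕ → GaugeConfig 4 (2 * S + 1) SU2 × (GaugeConfig 4 (2 * S + 1) SU2 × Ω) → ℝ :=
    fun k p => plaq S (U p.2.1 (k : NNReal) p.2.2)
  have hπ : Measurable (fun p : GaugeConfig 4 (2 * S + 1) SU2 × (GaugeConfig 4 (2 * S + 1) SU2 × Ω)
      => (p.1, p.2.2)) := measurable_fst.prodMk (measurable_snd.comp measurable_snd)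
  have hu : ∀ k, Measurable (u k) := fun k =>
    (measurable_plaq S).comp ((hmeas _).comp hπ)
  have hv : ∀ k, Measurable (v k) := fun k =>
    (measurable_plaq S).comp ((hmeas _).comp measurable_snd)
  let ν : Measure ℝ := μ.map (plaq S)
  haveI : IsProbabilityMeasure ν := Measure.isProbabilityMeasure_map (measurable_plaq S).aemeasurable
  have h1 : M.map (fun p : GaugeConfig 4 (2 * S + 1) SU2 × (GaugeConfig 4 (2 * S + 1) SU2 × Ω)
      => (p.1, p.2.2)) = μ.prod P := by
    have : (fun p : GaugeConfig 4 (2 * S + 1) SU2 × (GaugeConfig 4 (2 * S + 1) SU2 × Ω)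
        => (p.1, p.2.2)) = Prod.map id Prod.snd := rfl
    rw [this, ← Measure.map_prod_map _ _ measurable_id measurable_snd, Measure.map_id,
      Measure.map_snd_prod, measure_univ, one_smul]
  have h2 : M.map Prod.snd = μ.prod P := by
    show (μ.prod (μ.prod P)).map Prod.snd = μ.prod P
    rw [Measure.map_snd_prod, measure_univ, one_smul]
  have hlu : ∀ k, M.map (u k) = ν := by
    intro k
    have : u k = ((plaq S) ∘ (fun q : GaugeConfig 4 (2 * S + 1) SU2 × Ω => U q.1 (k : NNReal) q.2)) ∘
        (fun p : GaugeConfig 4 (2 * S + 1) SU2 × (GaugeConfig 4 (2 * S + 1) SU2 × Ω) => (p.1, p.2.2)) :=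
      rfl
    rw [this, ← Measure.map_map ((measurable_plaq S).comp (hmeas _)) hπ, h1,
      ← Measure.map_map (measurable_plaq S) (hmeas _), hstat]
  have hlv : ∀ k, M.map (v k) = ν := by
    intro k
    have : v k = ((plaq S) ∘ (fun q : GaugeConfig 4 (2 * S + 1) SU2 × Ω => U q.1 (k : NNReal) q.2)) ∘
        (Prod.snd : GaugeConfig 4 (2 * S + 1) SU2 × (GaugeConfig 4 (2 * S + 1) SU2 × Ω) → _) := rfl
    rw [this, ← Measure.map_map ((measurable_plaq S).comp (hmeas _)) measurable_snd, h2,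
      ← Measure.map_map (measurable_plaq S) (hmeas _), hstat]
  have hnc' : ∀ k : ℕ, M {p | u k p = v k p} = 0 := fun k => hnc k
  obtain ⟨E, hE, hslow⟩ := exists_slow_set M u v hu hv ν hlu hlv hnc' hγ
  obtain ⟨C, hC⟩ := hA (indicatorSpecies E hE)
  obtain ⟨k, hk⟩ := hslow C
  have hbound := hC S hS₁ Ω P W hW U hsol hmeas (k : NNReal)
  have hint : ∫ p, |(indicatorSpecies E hE).F (torusLift (2 * S + 1) (U p.1 (k : NNReal) p.2.2)) -
      (indicatorSpecies E hE).F (torusLift (2 * S + 1) (U p.2.1 (k : NNReal) p.2.2))| ∂M =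
      M.real (symmDiff (u k ⁻¹' E) (v k ⁻¹' E)) :=
    integral_abs_indicator_sub M (hu k) (hv k) hE
  have hbound' : M.real (symmDiff (u k ⁻¹' E) (v k ⁻¹' E)) ≤ C * Real.exp (-(γ * k)) := by
    have := hbound
    rw [hint] at this
    simpa using this
  exact absurd (lt_of_lt_of_le hk hbound') (lt_irrefl _)

end Summit.QuantumFields.YangMills.Theorems.TwoPointSynchronisation.Negative

end
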